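import Summits.CriticalPhenomena.PercolationContinuityZ3.Theorems.PercNearOneGluingNoHeavyLowerTailSunflowerComposition
import HarnessLib
import HarnessLib.Audit

/-!
# `NoHeavyLowerTail` (crux stmt-CriticalPhenomena-4575), abstract sunflower cubic: the partition lemma (rows H, G, T) holds on EVERY
# product-type and star-type composition — `θ ∘ (h₁,h₂,h₃)` and `θ' ∘ (h₁,h₂,h₃)` for arbitrary monotone Boolean gadgets on disjoint blocks

Support file (seat `prim-l12-p2` gen 9; `--supports stmt-CriticalPhenomena-4575`; companion of `…SunflowerComposition`).  No `sorry`,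
no named facts.  Memo: run/shared/lean/prim/prim-l12/prim-l12-p2/FINDING-g9-COMPOSITION.md.

The two outer maps on three generators (`prodOuter` = `θ`: top iff `≥ 2` generators on, petal `i` iff only generator `i`;
`starOuter` = `θ'`: top iff all three on, petal `i` iff exactly the other two) are COMB-positive for the kernels `s6H`, `s6G`, `s6T`
(`4³ = 64` fibre sums each, `decide +kernel`), so by `Sunflower.Zp_compose_nonneg_of_comb` the partition functionals `ZH`, `ZG`, `ZT`
(prove-1 gen 25/27: `PartitionLemmaH ⟹ H_{q+t}`, `PartitionLemmaT ⟹ γ`) are `≥ 0` on every block substitution into them: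
all AND/OR-products and stars `{j ∼ k}_i` with arbitrary group sizes and arbitrary monotone gadgets per group — in particular on the
doubled star (Lemma B slack `−1`, `…SunflowerPartitionLemmaBRefutation`), the tripled star (`S_B + S_C − 2N₁₂₃ = −178`, prove-1 gen 27),
and the co-stars (the first sunflowers without a good coordinate for the restriction-monotonicity induction, prim-l12-p2 gen 8 §3):
the census-extreme families of the partition lemma are now covered by a theorem.  (`ZH_nonneg_star_orClones`, `ZH_nonneg_prod_andGroups`
spell out the clone-group instances.)
-/

namespace Summit.CriticalPhenomena.PercolationContinuityZ3.Theorems.SunflowerPartition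

open Finset

/-! ## Reduction of COMB to finitely many fibres, and the two three-generator outer maps -/

section Outer

variable {ι : Type*} [Fintype ι] [DecidableEq ι]

/-- A fibre with an impossible size profile (some pattern of size `> 3`) is empty. [this work] -/
theorem ZF_eq_zero_of_three_lt (κ : Fin 5 → Fin 5 → Fin 5 → ℤ) (G : Sunflower ι) (c : ι → ℕ) {i : ι} (hi : 3 < c i) :
    ZF κ G c = 0 := by
  unfold ZF
  refine sum_eq_zero fun J hJ => ?_
  exfalso
  rw [mem_filter] at hJ
  have h1 : (J i).card ≤ 3 := by
    calc (J i).card ≤ (univ : Finset (Fin 3)).card := card_le_card (subset_univ _)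
      _ = 3 := by simp
  have h2 : (J i).card = c i := by rw [← hJ.2]; rfl
  omega

/-- COMB follows from the `4^ι` fibres with all pattern sizes `≤ 3`. [this work] -/
theorem comb_of_fin_four (κ : Fin 5 → Fin 5 → Fin 5 → ℤ) (G : Sunflower ι)
    (H : ∀ c : ι → Fin 4, 0 ≤ ZF κ G (fun i => ((c i : Fin 4) : ℕ))) : ∀ c : ι → ℕ, 0 ≤ ZF κ G c := by
  intro c
  by_cases hc : ∀ i, c i ≤ 3
  · have := H (fun i => ⟨c i, by have := hc i; omega⟩)
    convert this using 2
  · obtain ⟨i, hi⟩ := not_forall.1 hc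
    rw [ZF_eq_zero_of_three_lt κ G c (lt_of_not_ge hi)]

/-- The PRODUCT-TYPE outer map `θ` on three generators: top iff at least two generators are on, petal `i` iff exactly generator `i` is on,
bottom iff none (up-sets `V k = {S : k ∈ S ∨ 2 ≤ #S}`). Its block substitutions are the AND/OR-products and all their gadget
generalisations (petals on disjoint supports). [this work] -/
def prodOuter : Sunflower (Fin 3) where
  V k := univ.filter fun S => k ∈ S ∨ 2 ≤ S.card
  upper := by
    intro k S T hST hS
    have hS' : S ∈ univ.filter fun S : Finset (Fin 3) => k ∈ S ∨ 2 ≤ S.card := hS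
    show T ∈ univ.filter fun S : Finset (Fin 3) => k ∈ S ∨ 2 ≤ S.card
    rw [mem_filter] at hS' ⊢
    refine ⟨mem_univ _, ?_⟩
    rcases hS'.2 with h | h
    · exact Or.inl (hST h)
    · exact Or.inr (le_trans h (card_le_card hST))
  inter_eq := by decide

/-- The STAR-TYPE outer map `θ'` on three generators: top iff all three generators are on, petal `i` iff exactly the other two are on,
bottom iff at most one (up-sets `V k = {S : ∀ j ≠ k, j ∈ S}`). Its block substitutions are the stars `{j ∼ k}_i` with arbitrary
multiplicities and gadgets (the family violating Lemma B, and the first sunflowers without a good coordinate). [this work] -/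
def starOuter : Sunflower (Fin 3) where
  V k := univ.filter fun S => ∀ j, j ≠ k → j ∈ S
  upper := by
    intro k S T hST hS
    have hS' : S ∈ univ.filter fun S : Finset (Fin 3) => ∀ j, j ≠ k → j ∈ S := hS
    show T ∈ univ.filter fun S : Finset (Fin 3) => ∀ j, j ≠ k → j ∈ S
    rw [mem_filter] at hS' ⊢
    exact ⟨mem_univ _, fun j hj => hST (hS'.2 j hj)⟩
  inter_eq := by decide

/-- COMB for the product-type outer map, kernel `s6H` (64 fibres, checked by `decide`). [this work] -/
theorem comb_prodOuter_H : ∀ c : Fin 3 → Fin 4, 0 ≤ ZF s6H prodOuter (fun i => ((c i : Fin 4) : ℕ)) := by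
  decide +kernel

/-- COMB for the product-type outer map, kernel `s6G`. [this work] -/
theorem comb_prodOuter_G : ∀ c : Fin 3 → Fin 4, 0 ≤ ZF s6G prodOuter (fun i => ((c i : Fin 4) : ℕ)) := by
  decide +kernel

/-- COMB for the product-type outer map, kernel `s6T`. [this work] -/
theorem comb_prodOuter_T : ∀ c : Fin 3 → Fin 4, 0 ≤ ZF s6T prodOuter (fun i => ((c i : Fin 4) : ℕ)) := by
  decide +kernel

/-- COMB for the star-type outer map, kernel `s6H`. [this work] -/
theorem comb_starOuter_H : ∀ c : Fin 3 → Fin 4, 0 ≤ ZF s6H starOuter (fun i => ((c i : Fin 4) : ℕ)) := by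
  decide +kernel

/-- COMB for the star-type outer map, kernel `s6G`. [this work] -/
theorem comb_starOuter_G : ∀ c : Fin 3 → Fin 4, 0 ≤ ZF s6G starOuter (fun i => ((c i : Fin 4) : ℕ)) := by
  decide +kernel

/-- COMB for the star-type outer map, kernel `s6T`. [this work] -/
theorem comb_starOuter_T : ∀ c : Fin 3 → Fin 4, 0 ≤ ZF s6T starOuter (fun i => ((c i : Fin 4) : ℕ)) := by
  decide +kernel

end Outer

/-! ## The partition lemma (rows H, G, T) on every product-type and star-type composition -/

section Main

variable {β : Fin 3 → Type*} [∀ i, Fintype (β i)] [∀ i, DecidableEq (β i)]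

/-- **★_H on every product-type composition**: for arbitrary monotone Boolean gadgets `h₁, h₂, h₃` on disjoint blocks,
`0 ≤ ZH (θ ∘ (h₁,h₂,h₃))`. [this work] -/
theorem ZH_nonneg_prodOuter_compose (h : Gadget β) : 0 ≤ (prodOuter.compose h).ZH := by
  rw [Sunflower.ZH_eq_Zp]
  exact prodOuter.Zp_compose_nonneg_of_comb h s6H (comb_of_fin_four s6H prodOuter comb_prodOuter_H)

/-- ★_G on every product-type composition. [this work] -/
theorem ZG_nonneg_prodOuter_compose (h : Gadget β) : 0 ≤ (prodOuter.compose h).ZG := by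
  rw [Sunflower.ZG_eq_Zp]
  exact prodOuter.Zp_compose_nonneg_of_comb h s6G (comb_of_fin_four s6G prodOuter comb_prodOuter_G)

/-- ★_T on every product-type composition. [this work] -/
theorem ZT_nonneg_prodOuter_compose (h : Gadget β) : 0 ≤ (prodOuter.compose h).ZT := by
  rw [Sunflower.ZT_eq_Zp]
  exact prodOuter.Zp_compose_nonneg_of_comb h s6T (comb_of_fin_four s6T prodOuter comb_prodOuter_T)

/-- **★_H on every star-type composition**: for arbitrary monotone Boolean gadgets on disjoint blocks, `0 ≤ ZH (θ' ∘ (h₁,h₂,h₃))` —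
in particular on every multi-clone star (the sunflowers violating Lemma B, `…SunflowerPartitionLemmaBRefutation`). [this work] -/
theorem ZH_nonneg_starOuter_compose (h : Gadget β) : 0 ≤ (starOuter.compose h).ZH := by
  rw [Sunflower.ZH_eq_Zp]
  exact starOuter.Zp_compose_nonneg_of_comb h s6H (comb_of_fin_four s6H starOuter comb_starOuter_H)

/-- ★_G on every star-type composition. [this work] -/
theorem ZG_nonneg_starOuter_compose (h : Gadget β) : 0 ≤ (starOuter.compose h).ZG := by
  rw [Sunflower.ZG_eq_Zp]
  exact starOuter.Zp_compose_nonneg_of_comb h s6G (comb_of_fin_four s6G starOuter comb_starOuter_G)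

/-- ★_T on every star-type composition. [this work] -/
theorem ZT_nonneg_starOuter_compose (h : Gadget β) : 0 ≤ (starOuter.compose h).ZT := by
  rw [Sunflower.ZT_eq_Zp]
  exact starOuter.Zp_compose_nonneg_of_comb h s6T (comb_of_fin_four s6T starOuter comb_starOuter_T)

/-- The OR gadget on every block ("the block is hit": some element of the block lies in the set) — clone groups. [this work] -/
def orGadget (β : Fin 3 → Type*) [∀ i, DecidableEq (β i)] : Gadget β where
  h _ S := decide S.Nonempty
  mono := by
    intro i S T hST hS
    rw [decide_eq_true_eq] at hS ⊢
    exact hS.mono hST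

/-- The AND gadget on every block ("the whole block lies in the set"). [this work] -/
def andGadget (β : Fin 3 → Type*) [∀ i, Fintype (β i)] [∀ i, DecidableEq (β i)] : Gadget β where
  h _ S := decide (S = univ)
  mono := by
    intro i S T hST hS
    rw [decide_eq_true_eq] at hS ⊢
    rw [hS] at hST
    exact eq_univ_of_forall fun x => hST (mem_univ x)

/-- ★_H on the stars `{j ∼ k}_i` with ARBITRARY group sizes (OR-clone groups `β 0, β 1, β 2`): the doubled star (`|β i| = 2`, Lemma B
slack `−1`), the tripled star, … all satisfy the partition lemma. [this work] -/
theorem ZH_nonneg_star_orClones (β : Fin 3 → Type*) [∀ i, Fintype (β i)] [∀ i, DecidableEq (β i)] :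
    0 ≤ (starOuter.compose (orGadget β)).ZH :=
  ZH_nonneg_starOuter_compose (orGadget β)

/-- ★_H on the AND-products with arbitrary group sizes. [this work] -/
theorem ZH_nonneg_prod_andGroups (β : Fin 3 → Type*) [∀ i, Fintype (β i)] [∀ i, DecidableEq (β i)] :
    0 ≤ (prodOuter.compose (andGadget β)).ZH :=
  ZH_nonneg_prodOuter_compose (andGadget β)

end Main

end Summit.CriticalPhenomena.PercolationContinuityZ3.Theorems.SunflowerPartition
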